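import Summits.QuantumFields.YangMills.Theorems.UnitScaleTiltHalvingP1FlatCoreFrameLinStar
import Summits.QuantumFields.YangMills.Theorems.UnitScaleTiltProp8ChartDoubleBarSU2
import Literature.MathematicalPhysics.QuantumFieldTheory.Balaban1983to89.Node00.TorusCoverLevels
import Literature.MathematicalPhysics.QuantumFieldTheory.Balaban1983to89.B8SpecialUnitaryTrace
import HarnessLib

/-!
# Line H (`BirthV10.stub_halvingStep`, stmt-QuantumFields-19200), J4c (T4b)∕τ-thread: **THE STAIR ROWS `hH` ∕ `hWu` ∕ `hWτ` OF THE TOP MEMBER FROM FINE DATA ON THE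
# TOP BLOCK** — the `W`-side binders of ✓`P1FlatCoreTopRowsLocal.top121_of_local` ∕ `topReal_of_local` ∕ `topTrace_of_local` (stairs of `U̿^{(j)}W` in the blocks
# under a top label `yc`: size `δ`, unitarity, trace-free logarithm) DISCHARGED from the fine field's near-flatness ∕ unitarity ∕ `det = 1` on the fine territory of
# the top block `π_k yc` alone, with ONE budget at the top level

Cell `ym3-torus` (HUMAN RULING D-0037: YM₃ on T³ is ladder rung R3, NOT the Clay problem), width seat `ym-ust-19936-w3` (gen 7; τ-thread row (τ-1), LEAD-H L-10).
`--supports stmt-QuantumFields-19200 --as helper`; THEOREMS ONLY (0 `def`, 0 `sorry`); count-neutral; nothing here claims `core′`, `hSupU`, the stub, the crux or the gap.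

WHY.  The three top rows of ✓`P1FlatCoreTopStepTorus.hFP_kLevel_top_RD` (and the fourth, `hTopTrace`, of its τ-twin) are discharged by ✓`…TopRowsLocal`∕✓`…TopRowsReal`∕
✓`…TopRowsTrace` from tower-side data read on the blocks UNDER `yc`: for `j < k` and `z` with `⌊z ∕ L^{k−(j+1)}⌋ = yc`, the centre stairs `U̿^{(j)}W(Γ)` of the block of
`π_{j+1} z` must be within `δ` of `1` (`hH`), unitary (`hWu`, reality row) and trace-free in the logarithm (`hWτ`, trace row).  The STAGE-3b caller holds the fine field
`W` (`= (U♯)^g` of the supplier door) only through its values on the fine territory of the top block (near-flat within `s₀`; `SU(2)`-valued), and ONE budget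
`8·3800·((d+2)L)²·Lᵏ·s₀ ≤ 1`.  THIS FILE is the bookkeeping in between: §1 the territory nesting `B^{j+1} s = π_{j+1} z ∧ ⌊z∕L^{k−(j+1)}⌋ = yc ⇒ Bᵏ s = π_k yc`
(✓`Node00.blockOf_coverAt`, ✓`blockMap_blockMap`); §2 `hH` from ✓`P1FlatCoreFrameLinStar.norm_holT_stair_dbarIterU_sub_one_le_of_reads` with the single
`δ := 8·(d+2)L·Lᵏ·s₀`; §3 (`M₂(ℂ)`) `hWu` from ✓`holT_stair_dbarIterU_mem_unitaryGroup_of_reads`; §4 (`M₂(ℂ)`, `τ := trCLM (Fin 2)` of lit ✓`B8SpecialUnitaryTrace`)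
`det U̿^{(j)}W(Γ) = 1` on the read territory (✓`Prop8ChartDoubleBar.holT_pred_of_walk` ∘ ✓`det_dbarIterU_eq_one_of_reads`) and `hWτ` by lit
✓`BlockAveragingExpMeanLog.trace_mlog_eq_zero_of_det_eq_one` (winding guard `‖U̿(Γ) − 1‖ ≤ 1∕3` from §2 and the budget).

[cite: Balaban1985Averaging, (8)-(9) pp.18-19, (110) p.34, Prop. 4 (134)-(135) p.38; Balaban1987RG1, (0.1)-(0.5) pp.251-253; Balaban1985RegularSpaces, p.76, (1.17) p.78]
-/

set_option autoImplicit false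

noncomputable section

open scoped BigOperators Matrix.Norms.L2Operator
open NormedSpace

namespace Summit.QuantumFields.YangMills.Theorems.P1FlatCoreTopStairs

open Literature.MathematicalPhysics.QuantumFieldTheory.Balaban1983to89
open T4Continuum BlockAveraging AveragingRT ExpMeanLog MatrixLog
open B10Eq27TorusAxialLog (holT)
open B5Eq118OneStroke (iterBlockOf iterBlockOf_succ)
open B14DomainGeom (Pt)
open Node00 (coverAt blockOf_coverAt blockMap_blockMap)
open Literature.MathematicalPhysics.QuantumLattice (blockMap)
open B8SpecialUnitaryTrace (trCLM trCLM_apply)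
open Summit.QuantumFields.YangMills.Theorems.Prop8Chart
open Summit.QuantumFields.YangMills.Theorems.Prop8ChartDoubleBar (dbarIterU holT_pred_of_walk det_dbarIterU_eq_one_of_reads det_coe_units_inv_eq_one
  two_mul_lt_pi_of_le_third)
open Summit.QuantumFields.YangMills.Theorems.P1FlatCoreFrameLinStar (norm_holT_stair_dbarIterU_sub_one_le_of_reads holT_stair_dbarIterU_mem_unitaryGroup_of_reads)

variable {P : Params}

/-! ## §1 Territory nesting down the tower under a top label -/

section Nesting

/-- **LABELS COMPOSE DOWN THE TOWER, TORUS SIDE**: if the `j`-fold block point of a fine site `s` is `π_j z`, then its `(j+n)`-fold block point is `π_{j+n} ⌊z ∕ Lⁿ⌋`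
(iterate ✓`Node00.blockOf_coverAt`, compose the floors by ✓`blockMap_blockMap`). [cite: Balaban1987RG1, (0.1)-(0.3) pp.251-252] -/
theorem iterBlockOf_eq_coverAt_blockMap {j : ℕ} {s : Site P 0} {z : Pt P.d} (hs : iterBlockOf j s = coverAt P j z) :
    ∀ {n : ℕ}, j + n ≤ P.m + P.K → iterBlockOf (j + n) s = coverAt P (j + n) (blockMap (P.L ^ n) z)
  | 0, _ => by
    rw [Nat.add_zero, pow_zero, hs]
    congr 1
    funext μ
    simp [blockMap]
  | n + 1, hn => by
    show blockOf (iterBlockOf (j + n) s) = coverAt P (j + n + 1) (blockMap (P.L ^ (n + 1)) z)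
    rw [iterBlockOf_eq_coverAt_blockMap hs (by omega), blockOf_coverAt (by omega), blockMap_blockMap, pow_succ]

/-- **★ THE FINE TERRITORY OF A BLOCK UNDER `yc` LIES IN THE FINE TERRITORY OF THE TOP BLOCK `π_k yc`**: `B^{j+1} s = π_{j+1} z` and `⌊z ∕ L^{k−(j+1)}⌋ = yc`
(`j < k ≤ m + K`) give `Bᵏ s = π_k yc`. [cite: Balaban1987RG1, (0.1)-(0.3) pp.251-252] -/
theorem iterBlockOf_eq_coverAt_top {j k : ℕ} (hj : j < k) (hk : k ≤ P.m + P.K) {yc z : Pt P.d} (hz : blockMap (P.L ^ (k - (j + 1))) z = yc)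
    {s : Site P 0} (hs : iterBlockOf (j + 1) s = coverAt P (j + 1) z) : iterBlockOf k s = coverAt P k yc := by
  obtain ⟨n, rfl⟩ : ∃ n, k = j + 1 + n := ⟨k - (j + 1), by omega⟩
  rw [Nat.add_sub_cancel_left] at hz
  rw [iterBlockOf_eq_coverAt_blockMap hs hk, hz]

end Nesting

/-! ## §2 The stair window `hH` under `yc` from near-flatness on the top territory -/

section Window

variable {𝔸 : Type*} [NormedRing 𝔸] [NormedAlgebra ℂ 𝔸] [CompleteSpace 𝔸] [NormOneClass 𝔸]

/-- The budget descends: `8·3800·ℓ²·Lᵏ·s₀ ≤ 1` and `j ≤ k` give `8·3800·ℓ²·Lʲ·s₀ ≤ 1`. [folklore] -/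
theorem budget_of_le {j k : ℕ} (hjk : j ≤ k) {s₀ : ℝ} (hs₀ : 0 ≤ s₀)
    (hbudget : 8 * 3800 * (((P.d + 2) * P.L : ℕ) : ℝ) ^ 2 * (P.L : ℝ) ^ k * s₀ ≤ 1) :
    8 * 3800 * (((P.d + 2) * P.L : ℕ) : ℝ) ^ 2 * (P.L : ℝ) ^ j * s₀ ≤ 1 := by
  have hL1 : (1 : ℝ) ≤ P.L := by exact_mod_cast P.L_pos
  have hpow : (P.L : ℝ) ^ j ≤ (P.L : ℝ) ^ k := pow_le_pow_right₀ hL1 hjk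
  have h0 : 0 ≤ 8 * 3800 * (((P.d + 2) * P.L : ℕ) : ℝ) ^ 2 * s₀ := by positivity
  nlinarith

/-- Under the budget at level `k`, the stair window `8·(d+2)L·Lʲ·s₀` (`j ≤ k`) is at most `8·(d+2)L·Lᵏ·s₀ ≤ 1∕3800 ≤ 1∕3`. [folklore] -/
theorem stairWindow_le {j k : ℕ} (hjk : j ≤ k) {s₀ : ℝ} (hs₀ : 0 ≤ s₀)
    (hbudget : 8 * 3800 * (((P.d + 2) * P.L : ℕ) : ℝ) ^ 2 * (P.L : ℝ) ^ k * s₀ ≤ 1) :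
    8 * (((P.d + 2) * P.L : ℕ) : ℝ) * (P.L : ℝ) ^ j * s₀ ≤ 8 * (((P.d + 2) * P.L : ℕ) : ℝ) * (P.L : ℝ) ^ k * s₀ ∧
      8 * (((P.d + 2) * P.L : ℕ) : ℝ) * (P.L : ℝ) ^ k * s₀ ≤ 1 / 3 := by
  set ℓ : ℝ := (((P.d + 2) * P.L : ℕ) : ℝ) with hℓ
  have hℓ1 : (1 : ℝ) ≤ ℓ := by
    rw [hℓ]; exact_mod_cast Nat.one_le_iff_ne_zero.mpr (Nat.mul_ne_zero (by omega) (by have := P.hL.2; omega))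
  have hL1 : (1 : ℝ) ≤ P.L := by exact_mod_cast P.L_pos
  have hpow : (P.L : ℝ) ^ j ≤ (P.L : ℝ) ^ k := pow_le_pow_right₀ hL1 hjk
  have hx0 : 0 ≤ (P.L : ℝ) ^ k * s₀ := by positivity
  refine ⟨?_, ?_⟩
  · have h0 : 0 ≤ 8 * ℓ * s₀ := by positivity
    calc 8 * ℓ * (P.L : ℝ) ^ j * s₀ = 8 * ℓ * s₀ * (P.L : ℝ) ^ j := by ring
      _ ≤ 8 * ℓ * s₀ * (P.L : ℝ) ^ k := mul_le_mul_of_nonneg_left hpow h0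
      _ = 8 * ℓ * (P.L : ℝ) ^ k * s₀ := by ring
  · have h1 : ℓ * ((P.L : ℝ) ^ k * s₀) ≤ ℓ ^ 2 * ((P.L : ℝ) ^ k * s₀) := by
      have : ℓ ≤ ℓ ^ 2 := by nlinarith
      exact mul_le_mul_of_nonneg_right this hx0
    nlinarith

/-- **★ THE `hH` ROW UNDER `yc` FROM THE TOP TERRITORY**: if the fine field `U` is within `s₀` of `1` on every fine bond whose ends have `k`-fold block point `π_k yc`, and
`8·3800·((d+2)L)²·Lᵏ·s₀ ≤ 1`, then for `j < k` and every `z` with `⌊z ∕ L^{k−(j+1)}⌋ = yc`, every centre stair of `U̿^{(j)}` in the block of `π_{j+1} z` is within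
`δ := 8·(d+2)L·Lᵏ·s₀` of `1` — the `hH` binder of ✓`P1FlatCoreTopRowsLocal.top121_of_local`∕`top125_of_local`∕`topReal_of_local`∕`topTrace_of_local`
(✓`norm_holT_stair_dbarIterU_sub_one_le_of_reads` at level `j`, its read territory nested in the top one by §1). [cite: Balaban1985Averaging, (110) p.34, Prop. 4 (134)-(135) p.38] -/
theorem hH_top_of_reads {k : ℕ} (hk : k ≤ P.m + P.K) (yc : Pt P.d) (U : GaugeField P 0 𝔸ˣ) {s₀ : ℝ} (hs₀ : 0 ≤ s₀)
    (hbudget : 8 * 3800 * (((P.d + 2) * P.L : ℕ) : ℝ) ^ 2 * (P.L : ℝ) ^ k * s₀ ≤ 1)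
    (hU : ∀ b : PBond P 0, iterBlockOf k b.src = coverAt P k yc → iterBlockOf k b.tgt = coverAt P k yc → ‖((U b : 𝔸ˣ) : 𝔸) - 1‖ ≤ s₀) :
    ∀ j < k, ∀ z : Pt P.d, blockMap (P.L ^ (k - (j + 1))) z = yc → ∀ idx : Idx P,
      ‖((holT (dbarIterU j U) (emb (coverAt P (j + 1) z)) (stairWord idx.2.1 (off idx.1)) : 𝔸ˣ) : 𝔸) - 1‖ ≤
        8 * (((P.d + 2) * P.L : ℕ) : ℝ) * (P.L : ℝ) ^ k * s₀ := by
  intro j hj z hz idx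
  have h := norm_holT_stair_dbarIterU_sub_one_le_of_reads (by omega) (coverAt P (j + 1) z) U hs₀ (budget_of_le hj.le hs₀ hbudget)
    (fun b hs ht => hU b (iterBlockOf_eq_coverAt_top hj hk hz hs) (iterBlockOf_eq_coverAt_top hj hk hz ht)) idx
  exact h.trans (stairWindow_le hj.le hs₀ hbudget).1

end Window

/-! ## §3 The unitarity row `hWu` under `yc` on `M₂(ℂ)` -/

section Unitary

/-- **★ THE `hWu` ROW UNDER `yc` FROM THE TOP TERRITORY** (`M₂(ℂ)`): if the fine field is unitary and within `s₀` of `1` on every fine bond of the territory of `π_k yc`,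
`8·3800·((d+2)L)²·Lᵏ·s₀ ≤ 1`, then every centre stair of every `U̿^{(j)}`, `j < k`, in a block under `yc` is unitary — the `hWu` binder of ✓`topReal_of_local`
(✓`P1FlatCoreFrameLinStar.holT_stair_dbarIterU_mem_unitaryGroup_of_reads`, territory nesting §1). [cite: Balaban1985Averaging, (110) p.34, Prop. 4 (134)-(135) p.38; Balaban1987RG1, (0.5) p.253] -/
theorem hWu_top_of_reads {k : ℕ} (hk : k ≤ P.m + P.K) (yc : Pt P.d) (U : GaugeField P 0 (Matrix (Fin 2) (Fin 2) ℂ)ˣ) {s₀ : ℝ} (hs₀ : 0 ≤ s₀)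
    (hbudget : 8 * 3800 * (((P.d + 2) * P.L : ℕ) : ℝ) ^ 2 * (P.L : ℝ) ^ k * s₀ ≤ 1)
    (hU : ∀ b : PBond P 0, iterBlockOf k b.src = coverAt P k yc → iterBlockOf k b.tgt = coverAt P k yc →
      ‖((U b : (Matrix (Fin 2) (Fin 2) ℂ)ˣ) : Matrix (Fin 2) (Fin 2) ℂ) - 1‖ ≤ s₀)
    (hun : ∀ b : PBond P 0, iterBlockOf k b.src = coverAt P k yc → iterBlockOf k b.tgt = coverAt P k yc →
      ((U b : (Matrix (Fin 2) (Fin 2) ℂ)ˣ) : Matrix (Fin 2) (Fin 2) ℂ) ∈ Matrix.unitaryGroup (Fin 2) ℂ) :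
    ∀ j < k, ∀ z : Pt P.d, blockMap (P.L ^ (k - (j + 1))) z = yc → ∀ idx : Idx P,
      ((holT (dbarIterU j U) (emb (coverAt P (j + 1) z)) (stairWord idx.2.1 (off idx.1)) : (Matrix (Fin 2) (Fin 2) ℂ)ˣ) : Matrix (Fin 2) (Fin 2) ℂ) ∈
        unitary (Matrix (Fin 2) (Fin 2) ℂ) := by
  intro j hj z hz idx
  exact holT_stair_dbarIterU_mem_unitaryGroup_of_reads (by omega) (coverAt P (j + 1) z) U hs₀ (budget_of_le hj.le hs₀ hbudget)
    (fun b hs ht => hU b (iterBlockOf_eq_coverAt_top hj hk hz hs) (iterBlockOf_eq_coverAt_top hj hk hz ht))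
    (fun b hs ht => hun b (iterBlockOf_eq_coverAt_top hj hk hz hs) (iterBlockOf_eq_coverAt_top hj hk hz ht)) idx

end Unitary

/-! ## §4 `det = 1` along the stairs and the trace row `hWτ` under `yc` on `M₂(ℂ)` (`τ := tr`) -/

section Trace

/-- **`det U̿^{(i)}(Γ) = 1` FOR THE CENTRE STAIRS, READ TERRITORY = THE `(i+1)`-BLOCK OF `y`**: if the fine bonds whose `(i+1)`-fold block points are `y` carry `det = 1`
variables within `s₀` of `1`, `8·3800·((d+2)L)²·Lⁱ·s₀ ≤ 1`, then every centre stair of `U̿^{(i)}` in the block of `y` has `det = 1` (the multiplicative predicate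
`det = 1` along the stair walk, ✓`holT_pred_of_walk`; on the level-`i` bonds of the block by ✓`det_dbarIterU_eq_one_of_reads`; the stair walk reads only block-internal
bonds, ✓`blockOf_ends_of_mem_stairWalk`). [cite: Balaban1985Averaging, (8)-(9) pp.18-19, (110) p.34; Balaban1987RG1, before (0.5) p.253] -/
theorem det_holT_stair_dbarIterU_eq_one_of_reads {i : ℕ} (hi : i + 1 ≤ P.m + P.K) (y : Site P (i + 1))
    (U : GaugeField P 0 (Matrix (Fin 2) (Fin 2) ℂ)ˣ) {s₀ : ℝ} (hs₀ : 0 ≤ s₀)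
    (hbudget : 8 * 3800 * (((P.d + 2) * P.L : ℕ) : ℝ) ^ 2 * (P.L : ℝ) ^ i * s₀ ≤ 1)
    (hU : ∀ b : PBond P 0, iterBlockOf (i + 1) b.src = y → iterBlockOf (i + 1) b.tgt = y →
      ‖((U b : (Matrix (Fin 2) (Fin 2) ℂ)ˣ) : Matrix (Fin 2) (Fin 2) ℂ) - 1‖ ≤ s₀)
    (hdet : ∀ b : PBond P 0, iterBlockOf (i + 1) b.src = y → iterBlockOf (i + 1) b.tgt = y →
      ((U b : (Matrix (Fin 2) (Fin 2) ℂ)ˣ) : Matrix (Fin 2) (Fin 2) ℂ).det = 1) (idx : Idx P) :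
    ((holT (dbarIterU i U) (emb y) (stairWord idx.2.1 (off idx.1)) : (Matrix (Fin 2) (Fin 2) ℂ)ˣ) : Matrix (Fin 2) (Fin 2) ℂ).det = 1 := by
  set S : Set (Site P i) := {z | blockOf z = y} with hS
  have hF : ∀ e : PBond P i, e.src ∈ S → e.tgt ∈ S →
      ((dbarIterU i U e : (Matrix (Fin 2) (Fin 2) ℂ)ˣ) : Matrix (Fin 2) (Fin 2) ℂ).det = 1 := fun e hs ht =>
    det_dbarIterU_eq_one_of_reads (Nat.le_of_succ_le hi) S U hs₀ hbudget
      (fun b hs ht => hU b (by rw [iterBlockOf_succ]; exact hs) (by rw [iterBlockOf_succ]; exact ht))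
      (fun b hs ht => hdet b (by rw [iterBlockOf_succ]; exact hs) (by rw [iterBlockOf_succ]; exact ht)) e hs ht
  refine holT_pred_of_walk (fun a : (Matrix (Fin 2) (Fin 2) ℂ)ˣ => (a : Matrix (Fin 2) (Fin 2) ℂ).det = 1)
    (by rw [Units.val_one, Matrix.det_one]) (fun a b ha hb => by rw [Units.val_mul, Matrix.det_mul, ha, hb, one_mul])
    (fun a ha => det_coe_units_inv_eq_one ha) (dbarIterU i U) (emb y) _ fun st hst => ?_
  exact hF st.bond (blockOf_ends_of_mem_stairWalk hi y idx.1 idx.2.1 st hst).1 (blockOf_ends_of_mem_stairWalk hi y idx.1 idx.2.1 st hst).2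

/-- **`tr log U̿^{(i)}(Γ) = 0` FOR THE CENTRE STAIRS OF A `det = 1` FIELD, READ TERRITORY = THE `(i+1)`-BLOCK OF `y`** (`det = 1` by
✓`det_holT_stair_dbarIterU_eq_one_of_reads`, winding guard `‖U̿(Γ) − 1‖ ≤ 8ℓ·Lⁱ·s₀ ≤ 1∕3` by ✓`norm_holT_stair_dbarIterU_sub_one_le_of_reads` and the budget,
lit ✓`trace_mlog_eq_zero_of_det_eq_one`). [cite: Balaban1985RegularSpaces, p.76, (1.17) p.78; Balaban1985Averaging, (20)-(21) p.21, (110) p.34] -/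
theorem trCLM_mlog_holT_stair_dbarIterU_eq_zero_of_reads {i : ℕ} (hi : i + 1 ≤ P.m + P.K) (y : Site P (i + 1))
    (U : GaugeField P 0 (Matrix (Fin 2) (Fin 2) ℂ)ˣ) {s₀ : ℝ} (hs₀ : 0 ≤ s₀)
    (hbudget : 8 * 3800 * (((P.d + 2) * P.L : ℕ) : ℝ) ^ 2 * (P.L : ℝ) ^ i * s₀ ≤ 1)
    (hU : ∀ b : PBond P 0, iterBlockOf (i + 1) b.src = y → iterBlockOf (i + 1) b.tgt = y →
      ‖((U b : (Matrix (Fin 2) (Fin 2) ℂ)ˣ) : Matrix (Fin 2) (Fin 2) ℂ) - 1‖ ≤ s₀)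
    (hdet : ∀ b : PBond P 0, iterBlockOf (i + 1) b.src = y → iterBlockOf (i + 1) b.tgt = y →
      ((U b : (Matrix (Fin 2) (Fin 2) ℂ)ˣ) : Matrix (Fin 2) (Fin 2) ℂ).det = 1) (idx : Idx P) :
    trCLM (Fin 2) (mlog ((holT (dbarIterU i U) (emb y) (stairWord idx.2.1 (off idx.1)) : (Matrix (Fin 2) (Fin 2) ℂ)ˣ) : Matrix (Fin 2) (Fin 2) ℂ)) = 0 := by
  have hd := det_holT_stair_dbarIterU_eq_one_of_reads hi y U hs₀ hbudget hU hdet idx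
  have hsz := norm_holT_stair_dbarIterU_sub_one_le_of_reads hi y U hs₀ hbudget hU idx
  have h3 : ‖((holT (dbarIterU i U) (emb y) (stairWord idx.2.1 (off idx.1)) : (Matrix (Fin 2) (Fin 2) ℂ)ˣ) : Matrix (Fin 2) (Fin 2) ℂ) - 1‖ ≤ 1 / 3 :=
    hsz.trans ((stairWindow_le le_rfl hs₀ hbudget).2)
  rw [trCLM_apply]
  exact trace_mlog_eq_zero_of_det_eq_one hd h3 (two_mul_lt_pi_of_le_third h3)

/-- **★★ THE `hWτ` ROW UNDER `yc` FROM THE TOP TERRITORY** (`M₂(ℂ)`, `τ := tr`): if the fine field has `det = 1` and is within `s₀` of `1` on every fine bond of the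
territory of `π_k yc`, `8·3800·((d+2)L)²·Lᵏ·s₀ ≤ 1`, then every centre stair of every `U̿^{(j)}`, `j < k`, in a block under `yc` is trace-free in the logarithm —
the `hWτ` binder of ✓`P1FlatCoreTopRowsLocal.topTrace_of_local` at `τ := trCLM (Fin 2)` (`hτ` = lit ✓`B8SpecialUnitaryTrace.trCLM_mul_comm`).
[cite: Balaban1985RegularSpaces, p.76, (1.17) p.78; Balaban1985Averaging, (110) p.34, Prop. 4 (134)-(135) p.38] -/
theorem hWτ_top_of_reads {k : ℕ} (hk : k ≤ P.m + P.K) (yc : Pt P.d) (U : GaugeField P 0 (Matrix (Fin 2) (Fin 2) ℂ)ˣ) {s₀ : ℝ} (hs₀ : 0 ≤ s₀)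
    (hbudget : 8 * 3800 * (((P.d + 2) * P.L : ℕ) : ℝ) ^ 2 * (P.L : ℝ) ^ k * s₀ ≤ 1)
    (hU : ∀ b : PBond P 0, iterBlockOf k b.src = coverAt P k yc → iterBlockOf k b.tgt = coverAt P k yc →
      ‖((U b : (Matrix (Fin 2) (Fin 2) ℂ)ˣ) : Matrix (Fin 2) (Fin 2) ℂ) - 1‖ ≤ s₀)
    (hdet : ∀ b : PBond P 0, iterBlockOf k b.src = coverAt P k yc → iterBlockOf k b.tgt = coverAt P k yc →
      ((U b : (Matrix (Fin 2) (Fin 2) ℂ)ˣ) : Matrix (Fin 2) (Fin 2) ℂ).det = 1) :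
    ∀ j < k, ∀ z : Pt P.d, blockMap (P.L ^ (k - (j + 1))) z = yc → ∀ idx : Idx P,
      trCLM (Fin 2) (mlog ((holT (dbarIterU j U) (emb (coverAt P (j + 1) z)) (stairWord idx.2.1 (off idx.1)) : (Matrix (Fin 2) (Fin 2) ℂ)ˣ) :
        Matrix (Fin 2) (Fin 2) ℂ)) = 0 := by
  intro j hj z hz idx
  exact trCLM_mlog_holT_stair_dbarIterU_eq_zero_of_reads (by omega) (coverAt P (j + 1) z) U hs₀ (budget_of_le hj.le hs₀ hbudget)
    (fun b hs ht => hU b (iterBlockOf_eq_coverAt_top hj hk hz hs) (iterBlockOf_eq_coverAt_top hj hk hz ht))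
    (fun b hs ht => hdet b (iterBlockOf_eq_coverAt_top hj hk hz hs) (iterBlockOf_eq_coverAt_top hj hk hz ht)) idx

/-- **★★ THE `hWτ` ROW OF THE GLOBAL TRACE ROW** (`M₂(ℂ)`, `τ := tr`): for a field with `det = 1` bond variables within `s₀` of `1` everywhere and the budget at level
`k`, every centre stair of every `U̿^{(i)}`, `i < k`, is trace-free in the logarithm — the `hWτ` binder of ✓`P1FlatCoreFrameLinTrace.Cnl_trace_zero` at
`τ := trCLM (Fin 2)` (the det-twin of ✓`P1FlatCoreFrameLinStar.hWu_of_mem_unitaryGroup`). [cite: Balaban1985RegularSpaces, p.76, (1.17) p.78; Balaban1985Averaging, (110) p.34] -/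
theorem hWτ_of_det_eq_one {k : ℕ} (hk : k ≤ P.m + P.K) (U : GaugeField P 0 (Matrix (Fin 2) (Fin 2) ℂ)ˣ) {s₀ : ℝ} (hs₀ : 0 ≤ s₀)
    (hbudget : 8 * 3800 * (((P.d + 2) * P.L : ℕ) : ℝ) ^ 2 * (P.L : ℝ) ^ k * s₀ ≤ 1)
    (hU : ∀ b : PBond P 0, ‖((U b : (Matrix (Fin 2) (Fin 2) ℂ)ˣ) : Matrix (Fin 2) (Fin 2) ℂ) - 1‖ ≤ s₀)
    (hdet : ∀ b : PBond P 0, ((U b : (Matrix (Fin 2) (Fin 2) ℂ)ˣ) : Matrix (Fin 2) (Fin 2) ℂ).det = 1) :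
    ∀ i < k, ∀ (y : Site P (i + 1)) (idx : Idx P),
      trCLM (Fin 2) (mlog ((holT (dbarIterU i U) (emb y) (stairWord idx.2.1 (off idx.1)) : (Matrix (Fin 2) (Fin 2) ℂ)ˣ) : Matrix (Fin 2) (Fin 2) ℂ)) = 0 :=
  fun i hi y idx => trCLM_mlog_holT_stair_dbarIterU_eq_zero_of_reads (by omega) y U hs₀ (budget_of_le hi.le hs₀ hbudget) (fun b _ _ => hU b)
    (fun b _ _ => hdet b) idx

end Trace

end Summit.QuantumFields.YangMills.Theorems.P1FlatCoreTopStairs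

end
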